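import Literature.NumberTheory.Sieve.PolynomialCongruencesRootCount
import HarnessLib

/-!
# Local counts of a Bateman–Horn system at large primes (Bateman–Horn 1962, p. 364; Hensel)

Topic `Literature/NumberTheory/Sieve`, companion of `BatemanHorn.lean` / `BatemanHornProofs.lean` /
`PolynomialCongruencesRootCount.lean`. Everything in this file is PROVED (theorems only, no named
facts).

For a Bateman–Horn system `f = (fᵢ)_{i ∈ ι}` (`Literature.NumberTheory.Sieve.IsBatemanHornSystem`: each `fᵢ ∈ ℤ[X]`
irreducible with positive leading coefficient, pairwise non-associated, no fixed prime divisor)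
we prove that for all sufficiently large primes `p`:

1. `p ∤ lc fᵢ` for every `i` (`exists_forall_not_dvd_leadingCoeff`);
2. no two members have a common root modulo `p`: for `i ≠ j` and every `n ∈ ℤ`, not both
   `p ∣ fᵢ(n)` and `p ∣ fⱼ(n)` (`exists_forall_not_dvd_eval_and_dvd_eval`) — Bateman–Horn's
   resultant argument, p. 364: `a fᵢ + b fⱼ = c ≠ 0` (`exists_mul_add_mul_eq_C_of_not_associated`);
3. HENSEL: `#{n < p² : p² ∣ fᵢ(n)} ≤ deg fᵢ` (`exists_card_filter_sq_dvd_eval_le_natDegree`,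
   `exists_forall_card_filter_sq_dvd_eval_le`) — the case `a = 2` of the tree's
   `exists_forall_prime_polyRootCountMod_pow_eq` (`ρᵢ(p²) = ρᵢ(p) ≤ deg fᵢ` for `p ∤ E`,
   Hardy–Wright Thm 123: simple roots modulo `p` lift uniquely, `p ∤ Res(fᵢ, fᵢ') lc fᵢ`).

The three are packaged as `IsBatemanHornSystem.exists_localCounts`. These are the local inputs
(at the primes and the prime squares) of sieve-theoretic treatments of almost-prime values of
polynomial systems.

## References

* P. T. Bateman, R. A. Horn, *A heuristic asymptotic formula concerning the distribution of prime
  numbers*, Math. Comp. 16 (1962), 363–367, p. 364. [cite: BatemanHornMathComp1962, p. 364]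
* G. H. Hardy, E. M. Wright, *An Introduction to the Theory of Numbers*, 6th ed., OUP 2008, §8.3,
  Theorem 123. [cite: HardyWright2008, Thm 123 (§8.3)]
-/

noncomputable section

open Finset Polynomial

namespace Literature.NumberTheory.Sieve

variable {ι : Type*} [Fintype ι]

/-! ### Hensel count modulo `p²` -/

/-- For `g ∈ ℤ[X]` irreducible and non-constant and every sufficiently large prime `p`:
`#{n < p² : p² ∣ g(n)} ≤ deg g` (each of the `≤ deg g` roots modulo `p` is simple and lifts to
exactly one root modulo `p²`; the case `a = 2` of `exists_forall_prime_polyRootCountMod_pow_eq`).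
[cite: HardyWright2008, Thm 123 (§8.3)] -/
theorem exists_card_filter_sq_dvd_eval_le_natDegree {g : ℤ[X]} (hirr : Irreducible g)
    (hdeg : 0 < g.natDegree) :
    ∃ P₀ : ℕ, ∀ p : ℕ, p.Prime → P₀ < p →
      #((range (p ^ 2)).filter fun n : ℕ => ((p : ℤ) ^ 2) ∣ g.eval (n : ℤ)) ≤ g.natDegree := by
  obtain ⟨E, hE, h⟩ := exists_forall_prime_polyRootCountMod_pow_eq hirr hdeg
  refine ⟨E, fun p hp hP => ?_⟩
  have hpE : ¬ p ∣ E := fun hd => absurd (Nat.le_of_dvd (Nat.pos_of_ne_zero hE) hd) (not_le.mpr hP)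
  obtain ⟨h1, h2⟩ := h p hp hpE 2 (by norm_num)
  have h3 : #((range (p ^ 2)).filter fun n : ℕ => ((p : ℤ) ^ 2) ∣ g.eval (n : ℤ)) =
      polyRootCountMod ![g] (p ^ 2) := by
    rw [polyRootCountMod_single, Nat.cast_pow]
  rw [h3, h1]
  exact h2

/-! ### Systems -/

/-- For a finite family of non-zero `fᵢ ∈ ℤ[X]`, `p ∤ lc fᵢ` for every `i` once
`p > ∑ᵢ |lc fᵢ|`. [folklore] -/
theorem exists_forall_not_dvd_leadingCoeff (f : ι → ℤ[X]) (hf0 : ∀ i, f i ≠ 0) :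
    ∃ P₀ : ℕ, ∀ p : ℕ, P₀ < p → ∀ i, ¬ (p : ℤ) ∣ (f i).leadingCoeff := by
  refine ⟨∑ i, ((f i).leadingCoeff).natAbs, fun p hP i hdvd => ?_⟩
  have h1 : p ∣ ((f i).leadingCoeff).natAbs := Int.natCast_dvd.mp hdvd
  have h2 : ((f i).leadingCoeff).natAbs ≤ ∑ i, ((f i).leadingCoeff).natAbs :=
    Finset.single_le_sum (f := fun i => ((f i).leadingCoeff).natAbs) (fun _ _ => Nat.zero_le _)
      (mem_univ i)
  have h3 := Nat.le_of_dvd (Int.natAbs_pos.mpr (leadingCoeff_ne_zero.mpr (hf0 i))) h1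
  omega

/-- **Bateman–Horn 1962, p. 364**: irreducible, pairwise non-associated `fᵢ ∈ ℤ[X]` have
pairwise no common root modulo any sufficiently large prime `p` (`p > ∑ |cᵢⱼ|` where
`fᵢ aᵢⱼ + fⱼ bᵢⱼ = cᵢⱼ ≠ 0`): for `i ≠ j` and `n ∈ ℤ`, not both `p ∣ fᵢ(n)` and `p ∣ fⱼ(n)`.
[cite: BatemanHornMathComp1962, p. 364] -/
theorem exists_forall_not_dvd_eval_and_dvd_eval {f : ι → ℤ[X]} (hirr : ∀ i, Irreducible (f i))
    (hna : Pairwise fun i j => ¬Associated (f i) (f j)) :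
    ∃ P₀ : ℕ, ∀ p : ℕ, P₀ < p →
      ∀ i j, i ≠ j → ∀ n : ℤ, ¬ ((p : ℤ) ∣ (f i).eval n ∧ (p : ℤ) ∣ (f j).eval n) := by
  classical
  have key : ∀ i j : ι, i ≠ j → ∃ (a b : ℤ[X]) (c : ℤ), c ≠ 0 ∧ f i * a + f j * b = C c :=
    fun i j hij => exists_mul_add_mul_eq_C_of_not_associated (hirr i) (hirr j) (hna hij)
  choose! a b c hc0 hc using key
  refine ⟨∑ i, ∑ j, (c i j).natAbs, fun p hP i j hij n hn => ?_⟩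
  have hdvd : (p : ℤ) ∣ c i j := by
    have e := congrArg (eval n) (hc i j hij)
    rw [eval_add, eval_mul, eval_mul, eval_C] at e
    rw [← e]
    exact dvd_add (dvd_mul_of_dvd_left hn.1 _) (dvd_mul_of_dvd_left hn.2 _)
  have h1 : p ∣ (c i j).natAbs := Int.natCast_dvd.mp hdvd
  have h2 : (c i j).natAbs ≤ ∑ i, ∑ j, (c i j).natAbs :=
    (Finset.single_le_sum (f := fun j => (c i j).natAbs) (fun _ _ => Nat.zero_le _)
      (mem_univ j)).trans
      (Finset.single_le_sum (f := fun i => ∑ j, (c i j).natAbs) (fun _ _ => Nat.zero_le _)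
        (mem_univ i))
  have h3 := Nat.le_of_dvd (Int.natAbs_pos.mpr (hc0 i j hij)) h1
  omega

/-- Hensel count for a finite family of irreducible non-constant `fᵢ ∈ ℤ[X]`: for every
sufficiently large prime `p` and every `i`, `#{n < p² : p² ∣ fᵢ(n)} ≤ deg fᵢ`.
[cite: HardyWright2008, Thm 123 (§8.3)] -/
theorem exists_forall_card_filter_sq_dvd_eval_le {f : ι → ℤ[X]} (hirr : ∀ i, Irreducible (f i))
    (hdeg : ∀ i, 0 < (f i).natDegree) :
    ∃ P₀ : ℕ, ∀ p : ℕ, p.Prime → P₀ < p →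
      ∀ i, #((range (p ^ 2)).filter fun n : ℕ => ((p : ℤ) ^ 2) ∣ (f i).eval (n : ℤ)) ≤
        (f i).natDegree := by
  choose P hP using fun i => exists_card_filter_sq_dvd_eval_le_natDegree (hirr i) (hdeg i)
  refine ⟨∑ i, P i, fun p hp hlt i => hP i p hp (lt_of_le_of_lt ?_ hlt)⟩
  exact Finset.single_le_sum (f := P) (fun _ _ => Nat.zero_le _) (mem_univ i)

/-- **The local counts of a Bateman–Horn system at large primes.** For a Bateman–Horn system
`f = (fᵢ)` there is `P₀` such that for every prime `p > P₀`: (1) `p ∤ lc fᵢ` for all `i`;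
(2) for `i ≠ j` no `n ∈ ℤ` has `p ∣ fᵢ(n)` and `p ∣ fⱼ(n)` (Bateman–Horn 1962, p. 364,
resultants); (3) `#{n < p² : p² ∣ fᵢ(n)} ≤ deg fᵢ` for all `i` (Hensel: simple roots modulo `p`
lift uniquely modulo `p²`, for `p ∤ Res(fᵢ, fᵢ')`). [cite: BatemanHornMathComp1962, p. 364] -/
theorem IsBatemanHornSystem.exists_localCounts {f : ι → ℤ[X]} (hf : IsBatemanHornSystem f) :
    ∃ P₀ : ℕ, ∀ p : ℕ, p.Prime → P₀ < p →
      (∀ i, ¬ (p : ℤ) ∣ (f i).leadingCoeff) ∧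
      (∀ i j, i ≠ j → ∀ n : ℤ, ¬ ((p : ℤ) ∣ (f i).eval n ∧ (p : ℤ) ∣ (f j).eval n)) ∧
      (∀ i, #((range (p ^ 2)).filter fun n : ℕ => ((p : ℤ) ^ 2) ∣ (f i).eval (n : ℤ)) ≤
        (f i).natDegree) := by
  obtain ⟨P₁, h₁⟩ := exists_forall_not_dvd_leadingCoeff f fun i => (hf.irreducible i).ne_zero
  obtain ⟨P₂, h₂⟩ := exists_forall_not_dvd_eval_and_dvd_eval hf.irreducible
    hf.pairwise_not_associated
  obtain ⟨P₃, h₃⟩ := exists_forall_card_filter_sq_dvd_eval_le hf.irreducible hf.natDegree_pos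
  exact ⟨P₁ + P₂ + P₃, fun p hp hlt =>
    ⟨h₁ p (by omega), h₂ p (by omega), h₃ p hp (by omega)⟩⟩

end Literature.NumberTheory.Sieve

end
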